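import Mathlib
import HarnessLib
import Literature.MathematicalPhysics.KineticTheory.FouriersLaw
import Literature.MathematicalPhysics.KineticTheory.LangevinChainHormander
import Literature.MathematicalPhysics.KineticTheory.LangevinChainScalingLimit

/-!
# Device block coordinates (helper for stub `stub_terminationLocality`, line
`thermalise-then-cut-probe-insertion`, crux `JunctionLocality.SuperadditiveResistance`,
stmt-AtomisticToContinuum-11748) — part 1 of the block-restriction identity

The line's DEVICE for the split `(N, M)` lives on `PhaseSpace (N + M)`; termination locality
compares it with the bare `N`-chain (sites `0, …, N-1`) and the bare `M`-chain (sites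
`N, …, N+M-1`). The two block coordinate maps are
`π_N  x = (x.1 ∘ Fin.castAdd M, x.2 ∘ Fin.castAdd M) : PhaseSpace N` (left block) and
`π'_M x = (x.1 ∘ Fin.natAdd N, x.2 ∘ Fin.natAdd N) : PhaseSpace M` (right block), written out as
lambdas in every statement (no new definition, so the lemmas are about the tree's API only and
can be used next to any copy of the line vocabulary). Proved here, with NO differentiability
hypothesis (the one-variable slices coincide): the coordinate derivatives `partialQ/partialP` of
`FouriersLaw.lean` commute with the block maps on block sites and vanish off-block; and — from
the closed form `OscillatorChain.dPotential_eq_closed` — the force `∂Φ/∂q_i` of the big chain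
differs from the block's own force only at the junction sites `N-1`, `N`, by the junction bond
force `∓ V'(q_N − q_{N-1})` (`dPotential_castAdd`, `dPotential_natAdd`).
Part 2 (`…DeviceBlockRestriction.lean`) assembles the generator identities.
-/

noncomputable section

open Literature.MathematicalPhysics.KineticTheory.HeatConduction

namespace Summit.AtomisticToContinuum.FouriersLaw.Cruxes.SuperadditiveResistance.ThermaliseThenCutProbeInsertion

variable {N M : ℕ}

/-- Left-block and right-block indices are distinct. -/
theorem castAdd_ne_natAdd (i : Fin N) (j : Fin M) : Fin.castAdd M i ≠ Fin.natAdd N j := by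
  intro h
  have := congrArg Fin.val h
  simp at this
  omega

/-! ### First derivatives of block functions -/

/-- `∂_{q_i} (f ∘ π_N) = (∂_{q_i} f) ∘ π_N` for a left-block site (no differentiability needed:
the two one-variable slices coincide). -/
theorem partialQ_comp_restrictLeft_castAdd (f : PhaseSpace N → ℝ) (i : Fin N)
    (x : PhaseSpace (N + M)) :
    partialQ (Fin.castAdd M i)
        (f ∘ fun y : PhaseSpace (N + M) => (y.1 ∘ Fin.castAdd M, y.2 ∘ Fin.castAdd M)) x =
      partialQ i f (x.1 ∘ Fin.castAdd M, x.2 ∘ Fin.castAdd M) := by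
  unfold partialQ
  simp only [Function.comp_apply,
    Function.update_comp_eq_of_injective _ (Fin.castAdd_injective N M)]

/-- `∂_{p_i} (f ∘ π_N) = (∂_{p_i} f) ∘ π_N` for a left-block site. -/
theorem partialP_comp_restrictLeft_castAdd (f : PhaseSpace N → ℝ) (i : Fin N)
    (x : PhaseSpace (N + M)) :
    partialP (Fin.castAdd M i)
        (f ∘ fun y : PhaseSpace (N + M) => (y.1 ∘ Fin.castAdd M, y.2 ∘ Fin.castAdd M)) x =
      partialP i f (x.1 ∘ Fin.castAdd M, x.2 ∘ Fin.castAdd M) := by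
  unfold partialP
  simp only [Function.comp_apply,
    Function.update_comp_eq_of_injective _ (Fin.castAdd_injective N M)]

/-- `∂_{q_{N+j}} (f ∘ π_N) = 0`. -/
theorem partialQ_comp_restrictLeft_natAdd (f : PhaseSpace N → ℝ) (j : Fin M)
    (x : PhaseSpace (N + M)) :
    partialQ (Fin.natAdd N j)
        (f ∘ fun y : PhaseSpace (N + M) => (y.1 ∘ Fin.castAdd M, y.2 ∘ Fin.castAdd M)) x = 0 := by
  unfold partialQ
  simp only [Function.comp_apply,
    Function.update_comp_eq_of_forall_ne _ _ (fun i => castAdd_ne_natAdd i j), deriv_const]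

/-- `∂_{p_{N+j}} (f ∘ π_N) = 0`. -/
theorem partialP_comp_restrictLeft_natAdd (f : PhaseSpace N → ℝ) (j : Fin M)
    (x : PhaseSpace (N + M)) :
    partialP (Fin.natAdd N j)
        (f ∘ fun y : PhaseSpace (N + M) => (y.1 ∘ Fin.castAdd M, y.2 ∘ Fin.castAdd M)) x = 0 := by
  unfold partialP
  simp only [Function.comp_apply,
    Function.update_comp_eq_of_forall_ne _ _ (fun i => castAdd_ne_natAdd i j), deriv_const]

/-- `∂_{q_{N+j}} (f ∘ π'_M) = (∂_{q_j} f) ∘ π'_M`. -/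
theorem partialQ_comp_restrictRight_natAdd (f : PhaseSpace M → ℝ) (j : Fin M)
    (x : PhaseSpace (N + M)) :
    partialQ (Fin.natAdd N j)
        (f ∘ fun y : PhaseSpace (N + M) => (y.1 ∘ Fin.natAdd N, y.2 ∘ Fin.natAdd N)) x =
      partialQ j f (x.1 ∘ Fin.natAdd N, x.2 ∘ Fin.natAdd N) := by
  unfold partialQ
  simp only [Function.comp_apply,
    Function.update_comp_eq_of_injective _ (Fin.natAdd_injective M N)]

/-- `∂_{p_{N+j}} (f ∘ π'_M) = (∂_{p_j} f) ∘ π'_M`. -/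
theorem partialP_comp_restrictRight_natAdd (f : PhaseSpace M → ℝ) (j : Fin M)
    (x : PhaseSpace (N + M)) :
    partialP (Fin.natAdd N j)
        (f ∘ fun y : PhaseSpace (N + M) => (y.1 ∘ Fin.natAdd N, y.2 ∘ Fin.natAdd N)) x =
      partialP j f (x.1 ∘ Fin.natAdd N, x.2 ∘ Fin.natAdd N) := by
  unfold partialP
  simp only [Function.comp_apply,
    Function.update_comp_eq_of_injective _ (Fin.natAdd_injective M N)]

/-- `∂_{q_i} (f ∘ π'_M) = 0` for a left-block site `i`. -/
theorem partialQ_comp_restrictRight_castAdd (f : PhaseSpace M → ℝ) (i : Fin N)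
    (x : PhaseSpace (N + M)) :
    partialQ (Fin.castAdd M i)
        (f ∘ fun y : PhaseSpace (N + M) => (y.1 ∘ Fin.natAdd N, y.2 ∘ Fin.natAdd N)) x = 0 := by
  unfold partialQ
  simp only [Function.comp_apply,
    Function.update_comp_eq_of_forall_ne _ _ (fun j => (castAdd_ne_natAdd i j).symm),
    deriv_const]

/-- `∂_{p_i} (f ∘ π'_M) = 0` for a left-block site `i`. -/
theorem partialP_comp_restrictRight_castAdd (f : PhaseSpace M → ℝ) (i : Fin N)
    (x : PhaseSpace (N + M)) :
    partialP (Fin.castAdd M i)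
        (f ∘ fun y : PhaseSpace (N + M) => (y.1 ∘ Fin.natAdd N, y.2 ∘ Fin.natAdd N)) x = 0 := by
  unfold partialP
  simp only [Function.comp_apply,
    Function.update_comp_eq_of_forall_ne _ _ (fun j => (castAdd_ne_natAdd i j).symm),
    deriv_const]

/-! ### Second momentum derivatives -/

/-- `∂²_{p_i} (f ∘ π_N) = (∂²_{p_i} f) ∘ π_N` for a left-block site. -/
theorem partialP_partialP_comp_restrictLeft_castAdd (f : PhaseSpace N → ℝ) (i : Fin N)
    (x : PhaseSpace (N + M)) :
    partialP (Fin.castAdd M i) (partialP (Fin.castAdd M i)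
        (f ∘ fun y : PhaseSpace (N + M) => (y.1 ∘ Fin.castAdd M, y.2 ∘ Fin.castAdd M))) x =
      partialP i (partialP i f) (x.1 ∘ Fin.castAdd M, x.2 ∘ Fin.castAdd M) := by
  rw [show partialP (Fin.castAdd M i)
      (f ∘ fun y : PhaseSpace (N + M) => (y.1 ∘ Fin.castAdd M, y.2 ∘ Fin.castAdd M)) =
      partialP i f ∘ fun y : PhaseSpace (N + M) => (y.1 ∘ Fin.castAdd M, y.2 ∘ Fin.castAdd M) from
    funext fun x => partialP_comp_restrictLeft_castAdd f i x, partialP_comp_restrictLeft_castAdd]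

/-- `∂²_{p_{N+j}} (f ∘ π_N) = 0`. -/
theorem partialP_partialP_comp_restrictLeft_natAdd (f : PhaseSpace N → ℝ) (j : Fin M)
    (x : PhaseSpace (N + M)) :
    partialP (Fin.natAdd N j) (partialP (Fin.natAdd N j)
        (f ∘ fun y : PhaseSpace (N + M) => (y.1 ∘ Fin.castAdd M, y.2 ∘ Fin.castAdd M))) x =
      0 := by
  rw [show partialP (Fin.natAdd N j)
      (f ∘ fun y : PhaseSpace (N + M) => (y.1 ∘ Fin.castAdd M, y.2 ∘ Fin.castAdd M)) =
      fun _ => 0 from funext fun x => partialP_comp_restrictLeft_natAdd f j x]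
  unfold partialP
  simp

/-- `∂²_{p_{N+j}} (f ∘ π'_M) = (∂²_{p_j} f) ∘ π'_M`. -/
theorem partialP_partialP_comp_restrictRight_natAdd (f : PhaseSpace M → ℝ) (j : Fin M)
    (x : PhaseSpace (N + M)) :
    partialP (Fin.natAdd N j) (partialP (Fin.natAdd N j)
        (f ∘ fun y : PhaseSpace (N + M) => (y.1 ∘ Fin.natAdd N, y.2 ∘ Fin.natAdd N))) x =
      partialP j (partialP j f) (x.1 ∘ Fin.natAdd N, x.2 ∘ Fin.natAdd N) := by
  rw [show partialP (Fin.natAdd N j)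
      (f ∘ fun y : PhaseSpace (N + M) => (y.1 ∘ Fin.natAdd N, y.2 ∘ Fin.natAdd N)) =
      partialP j f ∘ fun y : PhaseSpace (N + M) => (y.1 ∘ Fin.natAdd N, y.2 ∘ Fin.natAdd N) from
    funext fun x => partialP_comp_restrictRight_natAdd f j x, partialP_comp_restrictRight_natAdd]

/-- `∂²_{p_i} (f ∘ π'_M) = 0` for a left-block site `i`. -/
theorem partialP_partialP_comp_restrictRight_castAdd (f : PhaseSpace M → ℝ) (i : Fin N)
    (x : PhaseSpace (N + M)) :
    partialP (Fin.castAdd M i) (partialP (Fin.castAdd M i)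
        (f ∘ fun y : PhaseSpace (N + M) => (y.1 ∘ Fin.natAdd N, y.2 ∘ Fin.natAdd N))) x =
      0 := by
  rw [show partialP (Fin.castAdd M i)
      (f ∘ fun y : PhaseSpace (N + M) => (y.1 ∘ Fin.natAdd N, y.2 ∘ Fin.natAdd N)) =
      fun _ => 0 from funext fun x => partialP_comp_restrictRight_castAdd f i x]
  unfold partialP
  simp

/-! ### The force: only the junction bond couples the blocks -/

/-- `∂Φ_{N+M}/∂q_i` at a LEFT-block site `i < N` is the left block's own `∂Φ_N/∂q_i` except at the
junction site `i = N - 1`, which also feels the junction bond: `- V'(q_N - q_{N-1})`. -/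
theorem dPotential_castAdd : ∀ {N M : ℕ} (P : OscillatorChain) (hM : 1 ≤ M) (i : Fin N) (q : Fin (N + M) → ℝ), P.dPotential (N + M) (Fin.castAdd M i) q = P.dPotential N i (q ∘ Fin.castAdd M) - (if i.val + 1 = N then deriv P.V (q ⟨N, by omega⟩ - q (Fin.castAdd M i)) else 0) := by
  intro N M P hM i q
  rw [P.dPotential_eq_closed, P.dPotential_eq_closed]
  simp only [Function.comp_apply, Fin.val_castAdd]
  have hL : (if h : 0 < i.val then
        deriv P.V (q (Fin.castAdd M i) - q ⟨i.val - 1, by omega⟩) else 0) =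
      (if h : 0 < i.val then
        deriv P.V (q (Fin.castAdd M i) - q (Fin.castAdd M ⟨i.val - 1, by omega⟩)) else 0) := by
    split_ifs <;> rfl
  have hR : (if h : i.val + 1 < N + M then
        deriv P.V (q ⟨i.val + 1, h⟩ - q (Fin.castAdd M i)) else 0) =
      (if h : i.val + 1 < N then
        deriv P.V (q (Fin.castAdd M ⟨i.val + 1, h⟩) - q (Fin.castAdd M i)) else 0) +
      (if i.val + 1 = N then deriv P.V (q ⟨N, by omega⟩ - q (Fin.castAdd M i)) else 0) := by
    by_cases h1 : i.val + 1 < N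
    · rw [dif_pos (by omega), dif_pos h1, if_neg (by omega), add_zero]
      rfl
    · have h2 : i.val + 1 = N := by have := i.isLt; omega
      rw [dif_pos (by omega), dif_neg h1, if_pos h2, zero_add]
      congr 3
      exact Fin.ext (by omega)
  rw [hL, hR]
  ring

/-- `∂Φ_{N+M}/∂q_{N+j}` at a RIGHT-block site is the right block's own `∂Φ_M/∂q_j` except at the
junction site `j = 0`, which also feels the junction bond: `+ V'(q_N - q_{N-1})`. -/
theorem dPotential_natAdd (P : OscillatorChain) (hN : 1 ≤ N) (j : Fin M)
    (q : Fin (N + M) → ℝ) :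
    P.dPotential (N + M) (Fin.natAdd N j) q =
      P.dPotential M j (q ∘ Fin.natAdd N) +
        (if j.val = 0 then deriv P.V (q (Fin.natAdd N j) - q ⟨N - 1, by omega⟩) else 0) := by
  rw [P.dPotential_eq_closed, P.dPotential_eq_closed]
  simp only [Function.comp_apply, Fin.val_natAdd]
  have hL : (if h : 0 < N + j.val then
        deriv P.V (q (Fin.natAdd N j) - q ⟨N + j.val - 1, by omega⟩) else 0) =
      (if h : 0 < j.val then
        deriv P.V (q (Fin.natAdd N j) - q (Fin.natAdd N ⟨j.val - 1, by omega⟩)) else 0) +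
      (if j.val = 0 then deriv P.V (q (Fin.natAdd N j) - q ⟨N - 1, by omega⟩) else 0) := by
    by_cases h1 : 0 < j.val
    · rw [dif_pos (by omega), dif_pos h1, if_neg (by omega), add_zero]
      congr 3
      exact Fin.ext (by simp only [Fin.val_natAdd]; omega)
    · have h2 : j.val = 0 := by omega
      rw [dif_pos (by omega), dif_neg h1, if_pos h2, zero_add]
      congr 3
      exact Fin.ext (show N + j.val - 1 = N - 1 by omega)
  have hR : (if h : N + j.val + 1 < N + M then
        deriv P.V (q ⟨N + j.val + 1, h⟩ - q (Fin.natAdd N j)) else 0) =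
      (if h : j.val + 1 < M then
        deriv P.V (q (Fin.natAdd N ⟨j.val + 1, h⟩) - q (Fin.natAdd N j)) else 0) := by
    by_cases h1 : j.val + 1 < M
    · rw [dif_pos (by omega), dif_pos h1]
      congr 3
    · rw [dif_neg (by omega), dif_neg h1]
  rw [hL, hR]
  ring

/-- The junction correction of `dPotential_castAdd`, multiplied out and summed over the left
block, is the single term at the junction site `N - 1`. -/
theorem sum_junction_castAdd (P : OscillatorChain) (hN : 1 ≤ N) (hM : 1 ≤ M)
    (q : Fin (N + M) → ℝ) (g : Fin N → ℝ) :
    (∑ i : Fin N, if i.val + 1 = N then deriv P.V (q ⟨N, by omega⟩ - q (Fin.castAdd M i)) * g i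
      else 0) = deriv P.V (q ⟨N, by omega⟩ - q ⟨N - 1, by omega⟩) * g ⟨N - 1, by omega⟩ := by
  rw [Finset.sum_eq_single ⟨N - 1, by omega⟩]
  · rw [if_pos (by simp; omega)]
    rfl
  · intro i _ hi
    rw [if_neg]
    intro h
    exact hi (Fin.ext (by simp; omega))
  · intro h; exact absurd (Finset.mem_univ _) h

/-- The junction correction of `dPotential_natAdd`, multiplied out and summed over the right
block, is the single term at the junction site `N` (= site `0` of the right block). -/
theorem sum_junction_natAdd (P : OscillatorChain) (hN : 1 ≤ N) (hM : 1 ≤ M)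
    (q : Fin (N + M) → ℝ) (g : Fin M → ℝ) :
    (∑ j : Fin M, if j.val = 0 then deriv P.V (q (Fin.natAdd N j) - q ⟨N - 1, by omega⟩) * g j
      else 0) = deriv P.V (q ⟨N, by omega⟩ - q ⟨N - 1, by omega⟩) * g ⟨0, by omega⟩ := by
  rw [Finset.sum_eq_single ⟨0, by omega⟩]
  · rw [if_pos rfl]
    rfl
  · intro j _ hj
    rw [if_neg]
    intro h
    exact hj (Fin.ext h)
  · intro h; exact absurd (Finset.mem_univ _) h

end Summit.AtomisticToContinuum.FouriersLaw.Cruxes.SuperadditiveResistance.ThermaliseThenCutProbeInsertion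

end
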